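import Summits.CriticalPhenomena.PercolationContinuityZ3.Theorems.PercNearOneGluingNoHeavyLowerTailTwoPartitionKeyToWB4
import HarnessLib.Audit

/-!
# `NoHeavyLowerTail` (crux stmt-CriticalPhenomena-4575), master-family hierarchy P3 (gen 27): `KeySandwich → KeyForm` — the two-up-set
# matching statement implies the whole chain `KeyForm → WB4 → WeightedBase → ThreeSetAntipodal` (→ SQKD)

Support file (seat `prim-masterthm-p3`; `--supports stmt-CriticalPhenomena-4575`; memo `FROM-prim-masterthm-p3-g27-KEY-TWO-LAYER.md` §1.1–1.2).

THE DICTIONARY (memo §1).  Given up-sets `𝒳 ⊆ ℬ`, `ℰ`, `𝒞`, apply `KeySandwich` to `𝒢 := 𝒳 ∪ (ℰ ∩ ℬ)`, `𝒰 := keyDual ℰ = {S : Sᶜ ∉ ℰ}` and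
`𝒴 := 𝒞`.  With `𝒜 := 𝒳 ∖ ℰ` one has `𝒢 = 𝒜 ⊔ (ℰ∩ℬ)`, `keySrcB 𝒢 𝒰 = 𝒜ᶜˢ ∖ 𝒢`, `keyTargets 𝒢 𝒰 ⊆ 𝒢`,
`(𝒢 ∖ keyTargets) ∖ 𝒜ᶜˢ ⊇ 𝒢 ∩ ℰᶜˢ`, and `ℬ ∩ ℰᶜˢ ⊆ (𝒢 ∩ ℰᶜˢ) ∪ keySrcA 𝒢 𝒰`; hence
`#(𝒞∩𝒢) − #(𝒞∩𝒜ᶜˢ) − #(𝒞∩ℬ∩ℰᶜˢ) ≥ #(𝒞∩𝒯) − #(𝒞∩𝒮_b) − #(𝒞∩𝒮_a) ≥ 0`, and the left-hand side equals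
`twoPartN 𝒳 𝒞 − twoPartN (𝒳∩ℰ) 𝒞 + twoPartN ℰ (ℬ∩𝒞)` (`keyForm_of_keySandwich`).  Corollary `threeSetAntipodal_of_keySandwich`.
HONEST LABEL: a reduction between open statements; nothing here bears on the crux. [this work]
-/

namespace Summit.CriticalPhenomena.PercolationContinuityZ3.Theorems.TwoPartition

open Finset
open scoped FinsetFamily

/-- **`KeySandwich ⟹ KeyForm`** (this work): the two-up-set matching form of KEY implies the sandwich form used by `wb4_of_keyForm`. [this work] -/
theorem keyForm_of_keySandwich (h : KeySandwich) : KeyForm := by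
  intro n 𝒳 ℰ ℬ 𝒞 h𝒳 hℰ hℬ h𝒞 hXB
  -- the instance
  set 𝒢 : Finset (Finset (Fin n)) := 𝒳 ∪ (ℰ ∩ ℬ) with hG
  set 𝒰 : Finset (Finset (Fin n)) := keyDual ℰ with hU
  set 𝒜 : Finset (Finset (Fin n)) := 𝒳 \ ℰ with hA
  have h𝒢 : IsUpperSet (𝒢 : Set (Finset (Fin n))) := by
    rw [hG, Finset.coe_union, Finset.coe_inter]; exact h𝒳.union (hℰ.inter hℬ)
  have h𝒰 : IsUpperSet (𝒰 : Set (Finset (Fin n))) := isUpperSet_keyDual hℰ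
  have KS := h n 𝒢 𝒰 𝒞 h𝒢 h𝒰 h𝒞
  -- membership characterisations
  have mG : ∀ S, S ∈ 𝒢 ↔ S ∈ 𝒳 ∨ (S ∈ ℰ ∧ S ∈ ℬ) := fun S => by rw [hG, mem_union, mem_inter]
  have mU : ∀ S, S ∈ 𝒰 ↔ Sᶜ ∉ ℰ := fun S => by rw [hU, mem_keyDual]
  have mA : ∀ S, S ∈ 𝒜 ↔ S ∈ 𝒳 ∧ S ∉ ℰ := fun S => by rw [hA, mem_sdiff]
  -- (F1) targets lie in 𝒢:  #(𝒞∩𝒢) = #(𝒞∩𝒯) + #(𝒞 ∩ 𝒢 ∖ 𝒯)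
  have f1 := card_filter_add_card_filter_not (s := 𝒞 ∩ 𝒢) (fun S => S ∈ keyTargets 𝒢 𝒰)
  have f1a : (𝒞 ∩ 𝒢).filter (fun S => S ∈ keyTargets 𝒢 𝒰) = 𝒞 ∩ keyTargets 𝒢 𝒰 := by
    ext S; simp only [mem_filter, mem_inter, keyTargets, mem_sdiff]; tauto
  rw [f1a] at f1
  -- (F2) 𝒮_b = 𝒜ᶜˢ ∖ 𝒢:  #(𝒞∩𝒜ᶜˢ) = #(𝒞∩𝒮_b) + #(𝒞∩𝒜ᶜˢ∩𝒢)
  have f2 := card_filter_add_card_filter_not (s := 𝒞 ∩ 𝒜ᶜˢ) (fun S => S ∈ 𝒢)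
  have f2a : (𝒞 ∩ 𝒜ᶜˢ).filter (fun S => ¬ S ∈ 𝒢) = 𝒞 ∩ keySrcB 𝒢 𝒰 := by
    ext S
    simp only [mem_filter, mem_inter, keySrcB, mem_sdiff, mem_compls, mA, mU, mG]
    constructor
    · rintro ⟨⟨hC, hX, hE⟩, hnG⟩; exact ⟨hC, ⟨hE, Or.inl hX⟩, hnG⟩
    · rintro ⟨hC, ⟨hE, hGc⟩, hnG⟩
      refine ⟨⟨hC, ?_, hE⟩, hnG⟩
      rcases hGc with hX | ⟨hE', _⟩
      · exact hX
      · exact absurd hE' hE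
  rw [f2a] at f2
  -- (F3) 𝒞 ∩ 𝒜ᶜˢ ∩ 𝒢 ⊆ 𝒞 ∩ 𝒢 ∖ 𝒯, and the difference contains 𝒞 ∩ 𝒢 ∩ ℰᶜˢ
  have f3 := card_filter_add_card_filter_not (s := (𝒞 ∩ 𝒢).filter (fun S => ¬ S ∈ keyTargets 𝒢 𝒰)) (fun S => S ∈ 𝒜ᶜˢ)
  have f3a : ((𝒞 ∩ 𝒢).filter (fun S => ¬ S ∈ keyTargets 𝒢 𝒰)).filter (fun S => S ∈ 𝒜ᶜˢ) = (𝒞 ∩ 𝒜ᶜˢ).filter (fun S => S ∈ 𝒢) := by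
    ext S
    simp only [mem_filter, mem_inter, keyTargets, mem_sdiff, mem_compls, mA, mU, mG, not_and, not_not]
    constructor
    · rintro ⟨⟨⟨hC, hGm⟩, _⟩, hX, hE⟩; exact ⟨⟨hC, hX, hE⟩, hGm⟩
    · rintro ⟨⟨hC, hX, hE⟩, hGm⟩
      exact ⟨⟨⟨hC, hGm⟩, fun _ => Or.inl hX⟩, hX, hE⟩
  have f3b : 𝒞 ∩ 𝒢 ∩ ℰᶜˢ ⊆ ((𝒞 ∩ 𝒢).filter (fun S => ¬ S ∈ keyTargets 𝒢 𝒰)).filter (fun S => ¬ S ∈ 𝒜ᶜˢ) := by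
    intro S hS
    rw [mem_inter, mem_inter, mem_compls] at hS
    obtain ⟨⟨hC, hSG⟩, hE⟩ := hS
    rw [mem_filter, mem_filter]
    refine ⟨⟨mem_inter.2 ⟨hC, hSG⟩, ?_⟩, ?_⟩
    · intro hT
      rw [keyTargets, mem_sdiff, mem_inter, mU] at hT
      exact hT.1.2 hE
    · intro hAc
      rw [mem_compls, mA] at hAc
      exact hAc.2 hE
  have c3b := card_le_card f3b
  rw [f3a] at f3
  -- (F4) ℬ ∩ ℰᶜˢ ⊆ (𝒢 ∩ ℰᶜˢ) ∪ 𝒮_a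
  have f4 : 𝒞 ∩ ℬ ∩ ℰᶜˢ ⊆ (𝒞 ∩ 𝒢 ∩ ℰᶜˢ) ∪ (𝒞 ∩ keySrcA 𝒢 𝒰) := by
    intro S hS
    simp only [mem_inter, mem_compls] at hS
    rw [mem_union]
    by_cases hSG : S ∈ 𝒢
    · exact Or.inl (by simp only [mem_inter, mem_compls]; exact ⟨⟨hS.1.1, hSG⟩, hS.2⟩)
    · right
      rw [mem_inter, keySrcA, mem_sdiff, mem_union, mem_keyInterior]
      refine ⟨hS.1.1, fun T hST => ?_, fun hh => hh.elim hSG fun hSU => (mU S).1 hSU hS.2⟩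
      rw [mem_union, mem_compls, mU, compl_compl, mG]
      by_cases hT : T ∈ ℰ
      · exact Or.inl (Or.inr ⟨hT, hℬ hST hS.1.2⟩)
      · exact Or.inr hT
  have c4 := (card_le_card f4).trans (card_union_le _ _)
  -- (F5) the three counts of KeyForm
  have g1 : #(𝒞 ∩ 𝒢) = #((𝒳 \ ℰ) ∩ 𝒞) + #(ℰ ∩ (ℬ ∩ 𝒞)) := by
    have := card_filter_add_card_filter_not (s := 𝒞 ∩ 𝒢) (fun S => S ∈ ℰ)
    have e1 : (𝒞 ∩ 𝒢).filter (fun S => S ∈ ℰ) = ℰ ∩ (ℬ ∩ 𝒞) := by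
      ext S; simp only [mem_filter, mem_inter, mG]
      constructor
      · rintro ⟨⟨hC, hGm⟩, hE⟩
        rcases hGm with hX | ⟨_, hB⟩
        · exact ⟨hE, hXB hX, hC⟩
        · exact ⟨hE, hB, hC⟩
      · rintro ⟨hE, hB, hC⟩; exact ⟨⟨hC, Or.inr ⟨hE, hB⟩⟩, hE⟩
    have e2 : (𝒞 ∩ 𝒢).filter (fun S => ¬ S ∈ ℰ) = (𝒳 \ ℰ) ∩ 𝒞 := by
      ext S; simp only [mem_filter, mem_inter, mem_sdiff, mG]
      constructor
      · rintro ⟨⟨hC, hGm⟩, hE⟩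
        rcases hGm with hX | ⟨hE', _⟩
        · exact ⟨⟨hX, hE⟩, hC⟩
        · exact absurd hE' hE
      · rintro ⟨⟨hX, hE⟩, hC⟩; exact ⟨⟨hC, Or.inl hX⟩, hE⟩
    rw [e1, e2] at this; omega
  have g2 : #(𝒞 ∩ 𝒜ᶜˢ) = #((𝒳 \ ℰ) ∩ 𝒞ᶜˢ) := by
    rw [← card_compls (𝒞 ∩ 𝒜ᶜˢ), compls_inter, compls_compls, inter_comm, hA]
  have g3 : #(𝒞 ∩ ℬ ∩ ℰᶜˢ) = #(ℰ ∩ (ℬ ∩ 𝒞)ᶜˢ) := by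
    rw [← card_compls (𝒞 ∩ ℬ ∩ ℰᶜˢ), compls_inter, compls_inter, compls_compls]
    congr 1; ext S; simp only [mem_inter, mem_compls]; tauto
  -- twoPartN bookkeeping
  have t1 : #(𝒳 ∩ 𝒞) = #(𝒳 ∩ ℰ ∩ 𝒞) + #((𝒳 \ ℰ) ∩ 𝒞) := by
    have := card_filter_add_card_filter_not (s := 𝒳 ∩ 𝒞) (fun S => S ∈ ℰ)
    have e1 : (𝒳 ∩ 𝒞).filter (fun S => S ∈ ℰ) = 𝒳 ∩ ℰ ∩ 𝒞 := by ext S; simp only [mem_filter, mem_inter]; tauto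
    have e2 : (𝒳 ∩ 𝒞).filter (fun S => ¬ S ∈ ℰ) = (𝒳 \ ℰ) ∩ 𝒞 := by ext S; simp only [mem_filter, mem_inter, mem_sdiff]; tauto
    rw [e1, e2] at this; omega
  have t2 : #(𝒳 ∩ 𝒞ᶜˢ) = #(𝒳 ∩ ℰ ∩ 𝒞ᶜˢ) + #((𝒳 \ ℰ) ∩ 𝒞ᶜˢ) := by
    have := card_filter_add_card_filter_not (s := 𝒳 ∩ 𝒞ᶜˢ) (fun S => S ∈ ℰ)
    have e1 : (𝒳 ∩ 𝒞ᶜˢ).filter (fun S => S ∈ ℰ) = 𝒳 ∩ ℰ ∩ 𝒞ᶜˢ := by ext S; simp only [mem_filter, mem_inter]; tauto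
    have e2 : (𝒳 ∩ 𝒞ᶜˢ).filter (fun S => ¬ S ∈ ℰ) = (𝒳 \ ℰ) ∩ 𝒞ᶜˢ := by ext S; simp only [mem_filter, mem_inter, mem_sdiff]; tauto
    rw [e1, e2] at this; omega
  unfold twoPartN
  rw [t1, t2]
  push_cast
  have KS' : (#(𝒞 ∩ keySrcA 𝒢 𝒰) : ℤ) + #(𝒞 ∩ keySrcB 𝒢 𝒰) ≤ #(𝒞 ∩ keyTargets 𝒢 𝒰) := by exact_mod_cast KS
  have hf1 : (#(𝒞 ∩ keyTargets 𝒢 𝒰) : ℤ) + #((𝒞 ∩ 𝒢).filter (fun S => ¬ S ∈ keyTargets 𝒢 𝒰)) = #(𝒞 ∩ 𝒢) := by exact_mod_cast f1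
  have hf2 : (#((𝒞 ∩ 𝒜ᶜˢ).filter (fun S => S ∈ 𝒢)) : ℤ) + #(𝒞 ∩ keySrcB 𝒢 𝒰) = #(𝒞 ∩ 𝒜ᶜˢ) := by exact_mod_cast f2
  have hf3 : (#((𝒞 ∩ 𝒜ᶜˢ).filter (fun S => S ∈ 𝒢)) : ℤ) + #(((𝒞 ∩ 𝒢).filter (fun S => ¬ S ∈ keyTargets 𝒢 𝒰)).filter (fun S => ¬ S ∈ 𝒜ᶜˢ))
      = #((𝒞 ∩ 𝒢).filter (fun S => ¬ S ∈ keyTargets 𝒢 𝒰)) := by exact_mod_cast f3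
  have hc3 : (#(𝒞 ∩ 𝒢 ∩ ℰᶜˢ) : ℤ) ≤ #(((𝒞 ∩ 𝒢).filter (fun S => ¬ S ∈ keyTargets 𝒢 𝒰)).filter (fun S => ¬ S ∈ 𝒜ᶜˢ)) := by
    exact_mod_cast c3b
  have hc4 : (#(𝒞 ∩ ℬ ∩ ℰᶜˢ) : ℤ) ≤ #(𝒞 ∩ 𝒢 ∩ ℰᶜˢ) + #(𝒞 ∩ keySrcA 𝒢 𝒰) := by exact_mod_cast c4
  have hg1 : (#(𝒞 ∩ 𝒢) : ℤ) = #((𝒳 \ ℰ) ∩ 𝒞) + #(ℰ ∩ (ℬ ∩ 𝒞)) := by exact_mod_cast g1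
  have hg2 : (#(𝒞 ∩ 𝒜ᶜˢ) : ℤ) = #((𝒳 \ ℰ) ∩ 𝒞ᶜˢ) := by exact_mod_cast g2
  have hg3 : (#(𝒞 ∩ ℬ ∩ ℰᶜˢ) : ℤ) = #(ℰ ∩ (ℬ ∩ 𝒞)ᶜˢ) := by exact_mod_cast g3
  linarith

/-- **`KeySandwich ⟹ ThreeSetAntipodal`** (this work): the kernel chain from the two-up-set matching form of KEY. [this work] -/
theorem threeSetAntipodal_of_keySandwich (h : KeySandwich) : ThreeSetAntipodal :=
  threeSetAntipodal_of_weightedBase (weightedBase_of_wb4 (wb4_of_keyForm (keyForm_of_keySandwich h)))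

end Summit.CriticalPhenomena.PercolationContinuityZ3.Theorems.TwoPartition
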